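/-
Copyright (c) 2026 the pub-hodgecm-mathlib formalisation cell (harness21).  Prover seat hodgecm-mathlib-K2E1-p08 (g6), Track B ∕ K2-LIT
(build stream 29), h413 = `stmt-HodgeConjecture-24833`, line `K2_E1_TraceFormulaBeta`, campaign «EIS-R7-BL-SPH-2» (Bernstein–Lapid soft continuation of
the spherical Borel Eisenstein series), file «P2a-ι §4bis» (every rank); dealer K2E1-plan (g5) DEALS 2026-09-04T09:04:14Z (`hright`) + 09:07:50Z (`hdis`).
-/
import Summits.HodgeConjecture.HodgeConjecture.Theorems.K2E1BLIotaUnfoldingU               -- ★ p858806 (this seat): the measure letter `hμZ`, `B(F)♯` plumbing, leaf 1 ED. 2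
import HarnessLib

/-!
# h413 ∕ Track B «K2-LIT», campaign «EIS-R7-BL-SPH-2» — helper `K2E1BLQuotientMeasureU` («P2a-ι §4bis», EVERY RANK): THE MEASURE LETTER `hμZ` IN THREE CURRENCIES —
# `μZ = π_*(β · ν_G)`, the Bochner unfolding of `μZ` and of `wtm_{k,c} μZ`, and RIGHT-INVARIANCE of `μZ` (P3's letter `hright`)

Cell `pub/hodgecm-mathlib`, crux H413 = `stmt-HodgeConjecture-24833`, route of record `HCCMUnconditional`; chair K2-lead (g1), dealer K2E1-plan (g5) (RULING D2 08:59:22Z «the measure letters of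
record are K2E1-p08's `hμZ` + `hβ`»; 09:04:14Z «`hright : ∀ y, MeasurePreserving (rightShift y) μZ μZ` — its discharge from the letters of record is ONE lemma, assigned → K2E1-p08»; 09:07:50Z
«P2b's `hdis` = μw invariant under fibre averaging — K2E1-p08 discharges from `hμZ`+`hβ`»).  THEOREMS ONLY (no `def`, no `instance`, no `notation`, no named-fact hypothesis, no `sorry`); lane
`--kind proof --supports stmt-HodgeConjecture-24833 --as helper` (count-neutral).  Currency of ★ leaf 1 ED. 2 `K2E1BLBorelSpacesU2Defs` (`Z = B(F)∖G(𝔸) = borelQuotient`, `π = toBorelQuotient`,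
`HZ`, `rightShift`, `zFun`, `wtm = weightedTruncMeasure k c μZ = (μZ|_{c<HZ}).withDensity HZ^{−2k}`) and of ★ `K2E1BLIotaUnfoldingU` (the letter
`hμZ : ∀ f Borel, ∫⁻_Z f dμZ = ∫⁻_𝔾 β · f∘π dν_G`, `hβ : IsCoveringWeight B(F)♯ β`).  Every rank `N` (clone discipline: serves BL-SPH-3 verbatim); the `N = 2, 3` instances of §4 only
discharge ★ AVG's conjugation letter `hconj` by the product formula (★ `map_conj_toAdelic_eq_self_two ∕ _three`).

* §1 **`map_toBorelQuotient_withDensity_eq_of_unfolding`** — the letter says `μZ = π_*(β · ν_G)` (Mathlib `Measure.ext_of_lintegral`); **`integral_eq_integral_toReal_smul_comp_of_unfolding`** — the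
  BOCHNER form `∫_Z f dμZ = ∫_𝔾 (β g).toReal • f(π g) dν_G` for every `f` a.e.-strongly measurable w.r.t. `μZ` (any Banach target; `integral_map` + `integral_withDensity_eq_integral_toReal_smul`).
* §2 **`measurePreserving_rightShift_of_unfolding (hβ) (hμZ) [ν_G.IsMulRightInvariant] (y) : MeasurePreserving (rightShift y) μZ μZ`** — P3's letter `hright` (K2E1-p09): unfold with `β`,
  translate `g ↦ g y⁻¹` inside the right-invariant `ν_G`, and observe that `β(· y⁻¹)` is again a `B(F)♯`-covering weight (the right shift commutes with the left action), so weight independence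
  (★ `lintegral_mul_eq_of_coveringSum_eq`) returns to `β`.
* §3 THE WEIGHTED TRUNCATED MEASURE UNFOLDED: `lintegral_weightedTruncMeasure_eq_of_unfolding` (`∫⁻ f d(wtm) = ∫⁻ β · 𝟙_{c<H} H^{−2k} · f∘π dν_G`, Borel `f ≥ 0`),
  `aestronglyMeasurable_indicator_smul_of_weightedTruncMeasure` and **`integral_weightedTruncMeasure_eq_of_unfolding`** (the Bochner form for `f` a.e.-strongly measurable w.r.t. `wtm`:
  `∫ f d(wtm) = ∫_𝔾 (β g).toReal • 𝟙_{c<H(g)} H(g)^{−2k} • f(π g) dν_G`).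
* (sequel file `K2E1BLFibreAverageInvarianceU`) P2b's DISINTEGRATION LETTER `hdis` — `∫_Z zFun Φ_B d(wtm) = ∫_Z zFun Φ d(wtm)` — from §3 + ★ AVG.

HONEST LABEL.  Count-neutral helper of the BL-SPH-2 template (consumers: P3 B `hright` (K2E1-p09), P2b-A `hdis` (K2-defs1), K1-L² (K2E1-p11)); closes no socket; HC_CM is proved only modulo the 7
printed citations (2 remaining named inputs: hLiu418 = `stmt-HodgeConjecture-24832`, h413 = `stmt-HodgeConjecture-24833`) until rung 0 closes.

## References
* [BernsteinLapid2019] J. Bernstein, E. Lapid, *On the meromorphic continuation of Eisenstein series*, J. Amer. Math. Soc. 37 (2024) (arXiv:1911.02342), §4 Claim 4 (p. 10).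
* [MoeglinWaldspurger1995] C. Mœglin, J.-L. Waldspurger, *Spectral Decomposition and Eisenstein Series* (1995), I.2.1, I.2.6, II.1.7–II.1.8.
* [WeilIntegration1965] A. Weil, *L'intégration dans les groupes topologiques et ses applications* (1940), §9 (quotient measures).
* [Borel1963] A. Borel, *Some finiteness properties of adele groups over number fields*, Publ. Math. IHÉS 16 (1963), §5.
-/

set_option autoImplicit false
-- the mandated namespace repeats `HodgeConjecture.HodgeConjecture`, as in every `Theorems/*.lean` of this sub-problem
set_option linter.dupNamespace false

noncomputable section

open MeasureTheory MeasureTheory.Measure Set NumberField IsDedekindDomain Filter Topology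
open scoped NNReal ENNReal
open Literature.MeasureTheory.Group Literature.NumberTheory.Automorphic Literature.NumberTheory.Automorphic.UnitaryGroup AdelicGroupData
open Summit.HodgeConjecture.HodgeConjecture.Cruxes.H413.K2E1BLBorelSpacesU2Defs
open Summit.HodgeConjecture.HodgeConjecture.Cruxes.H413.K2E1BLIotaUnfoldingU

namespace Summit.HodgeConjecture.HodgeConjecture.Cruxes.H413.K2E1BLQuotientMeasureU

variable {F E : Type} [Field F] [NumberField F] [Field E] [NumberField E] [Algebra F E] {c : E ≃ₐ[F] E} {N : ℕ}
  [MeasurableSpace (quasiSplit F E c N).Adelic] [BorelSpace (quasiSplit F E c N).Adelic]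

/-! ## §1 The letter as `μZ = π_*(β · ν_G)` and its Bochner form -/

/-- **`μZ = π_*(β · ν_G)`**: under the letter `hμZ`, `μZ` IS the push-forward along `π : 𝔾 → Z` of the weighted Haar measure `ν_G.withDensity β` (Mathlib `Measure.ext_of_lintegral`).
[cite: WeilIntegration1965, §9] -/
theorem map_toBorelQuotient_withDensity_eq_of_unfolding (νG : Measure (quasiSplit F E c N).Adelic)
    {β : (quasiSplit F E c N).Adelic → ℝ≥0∞} (hβ : IsCoveringWeight ↥((arithmeticBorel F E c N).map (quasiSplit F E c N).arithmeticSubgroup.subtype) β)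
    {μZ : Measure (borelQuotient F E c N)}
    (hμZ : ∀ f : borelQuotient F E c N → ℝ≥0∞, Measurable f → ∫⁻ z, f z ∂μZ = ∫⁻ g, β g * f (toBorelQuotient F E c N g) ∂νG) :
    Measure.map (toBorelQuotient F E c N) (νG.withDensity β) = μZ := by
  refine Measure.ext_of_lintegral _ fun f hf => ?_
  rw [lintegral_map hf (continuous_toBorelQuotient F E c N).measurable,
    lintegral_withDensity_eq_lintegral_mul _ hβ.measurable (g := fun a => f (toBorelQuotient F E c N a)) (hf.comp (continuous_toBorelQuotient F E c N).measurable),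
    hμZ f hf]
  rfl

/-- **THE BOCHNER UNFOLDING of `μZ`**: `∫_Z f dμZ = ∫_𝔾 (β g).toReal • f(π g) dν_G` for every `f` a.e.-strongly measurable w.r.t. `μZ`, with values in any Banach space (`μZ = π_*(β ν_G)`, Mathlib
`integral_map`, `integral_withDensity_eq_integral_toReal_smul`; `β ≤ 1` is finite). [cite: WeilIntegration1965, §9] [cite: MoeglinWaldspurger1995, I.2.1] -/
theorem integral_eq_integral_toReal_smul_comp_of_unfolding {V : Type*} [NormedAddCommGroup V] [NormedSpace ℝ V] [CompleteSpace V]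
    (νG : Measure (quasiSplit F E c N).Adelic)
    {β : (quasiSplit F E c N).Adelic → ℝ≥0∞} (hβ : IsCoveringWeight ↥((arithmeticBorel F E c N).map (quasiSplit F E c N).arithmeticSubgroup.subtype) β)
    {μZ : Measure (borelQuotient F E c N)}
    (hμZ : ∀ f : borelQuotient F E c N → ℝ≥0∞, Measurable f → ∫⁻ z, f z ∂μZ = ∫⁻ g, β g * f (toBorelQuotient F E c N g) ∂νG)
    {f : borelQuotient F E c N → V} (hf : AEStronglyMeasurable f μZ) :
    ∫ z, f z ∂μZ = ∫ g, (β g).toReal • f (toBorelQuotient F E c N g) ∂νG := by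
  have hmap := map_toBorelQuotient_withDensity_eq_of_unfolding νG hβ hμZ
  have hf' : AEStronglyMeasurable f (Measure.map (toBorelQuotient F E c N) (νG.withDensity β)) := by rwa [hmap]
  rw [← hmap, integral_map (continuous_toBorelQuotient F E c N).measurable.aemeasurable hf',
    integral_withDensity_eq_integral_toReal_smul hβ.measurable (Eventually.of_forall fun g => lt_of_le_of_lt (hβ.le_one g) ENNReal.one_lt_top)]

/-! ## §2 `μZ` is invariant under the right shifts `[g] ↦ [g y]` (P3's letter `hright`) -/

/-- `β(· y⁻¹)` is again a `B(F)♯`-covering weight (the right shift commutes with the left `B(F)`-action). [cite: BernsteinLapid2019, §4 p. 10] -/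
theorem isCoveringWeight_comp_mul_right {β : (quasiSplit F E c N).Adelic → ℝ≥0∞}
    (hβ : IsCoveringWeight ↥((arithmeticBorel F E c N).map (quasiSplit F E c N).arithmeticSubgroup.subtype) β) (y : (quasiSplit F E c N).Adelic) :
    IsCoveringWeight ↥((arithmeticBorel F E c N).map (quasiSplit F E c N).arithmeticSubgroup.subtype) (fun g => β (g * y⁻¹)) := by
  refine ⟨hβ.measurable.comp (measurable_id.mul_const _), fun g => ?_⟩
  have h := hβ.coveringSum_eq (g * y⁻¹)
  rw [coveringSum_apply] at h ⊢
  simpa only [Subgroup.smul_def, smul_eq_mul, mul_assoc] using h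

/-- **`μZ` IS RIGHT-INVARIANT**: for every `y ∈ 𝔾` the right shift `rightShift y : Z → Z`, `B(F)·g ↦ B(F)·g y`, PRESERVES `μZ` — the letter `hright` of P3 B (`K2E1BLHeckeOperatorWeightedU2`) under the
letters of record, given right-invariance of `ν_G` (`𝔾` is unimodular: ★ `forall_isHaarMeasure_isMulRightInvariant_quasiSplit_cm`).  Proof: `∫⁻ f∘r_y dμZ = ∫⁻ β(g) f(π(g y)) dν_G =
∫⁻ β(g y⁻¹) f(π g) dν_G` (right-invariance) `= ∫⁻ β(g) f(π g) dν_G` (both `β` and `β(· y⁻¹)` are `B(F)♯`-weights and `f∘π` is left-`B(F)`-invariant, ★ `lintegral_mul_eq_of_coveringSum_eq`).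
[cite: BernsteinLapid2019, §4 p. 10] [cite: WeilIntegration1965, §9] -/
theorem measurePreserving_rightShift_of_unfolding (νG : Measure (quasiSplit F E c N).Adelic) [νG.IsMulLeftInvariant] [νG.IsMulRightInvariant]
    {β : (quasiSplit F E c N).Adelic → ℝ≥0∞} (hβ : IsCoveringWeight ↥((arithmeticBorel F E c N).map (quasiSplit F E c N).arithmeticSubgroup.subtype) β)
    {μZ : Measure (borelQuotient F E c N)}
    (hμZ : ∀ f : borelQuotient F E c N → ℝ≥0∞, Measurable f → ∫⁻ z, f z ∂μZ = ∫⁻ g, β g * f (toBorelQuotient F E c N g) ∂νG)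
    (y : (quasiSplit F E c N).Adelic) :
    MeasurePreserving (rightShift F E c N y) μZ μZ := by
  classical
  set Γ : Subgroup (quasiSplit F E c N).Adelic := (arithmeticBorel F E c N).map (quasiSplit F E c N).arithmeticSubgroup.subtype with hΓ
  haveI := discreteTopology_map_arithmeticBorel (F := F) (E := E) (c := c) (N := N)
  haveI := t2Space_adeleRing_of_numberField E
  haveI := locallyCompactSpace_adeleRing' E
  haveI := secondCountableTopology_adeleRing E
  haveI : SecondCountableTopology (quasiSplit F E c N).Adelic := inferInstanceAs (SecondCountableTopology (adelic F E c N ((StdForm.antidiagonal N).over E)))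
  haveI : Countable Γ := by
    haveI : SecondCountableTopology Γ := TopologicalSpace.Subtype.secondCountableTopology _
    exact countable_of_Lindelof_of_discrete
  haveI := K2E1IntertwiningAdjointEngine.measurableConstSMul_subgroup Γ
  haveI := K2E1IntertwiningAdjointEngine.smulInvariantMeasure_subgroup Γ νG
  have hrm : Measurable (rightShift F E c N y) := (continuous_rightShift F E c N y).measurable
  have hπm : Measurable (toBorelQuotient F E c N) := (continuous_toBorelQuotient F E c N).measurable
  refine ⟨hrm, Measure.ext_of_lintegral _ fun f hf => ?_⟩
  rw [lintegral_map hf hrm, hμZ (fun z => f (rightShift F E c N y z)) (hf.comp hrm)]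
  -- `∫⁻ β(g) f(π(g y)) = ∫⁻ β(g y⁻¹) f(π g)` by right-invariance
  have h1 : ∫⁻ g, β g * f (rightShift F E c N y (toBorelQuotient F E c N g)) ∂νG = ∫⁻ g, β (g * y⁻¹) * f (toBorelQuotient F E c N g) ∂νG := by
    rw [← lintegral_mul_right_eq_self (μ := νG) (fun g => β (g * y⁻¹) * f (toBorelQuotient F E c N g)) y]
    refine lintegral_congr fun g => ?_
    simp only [rightShift_toBorelQuotient, mul_inv_cancel_right]
  rw [h1, hμZ f hf]
  -- weight independence: both `β(· y⁻¹)` and `β` are `B(F)♯`-weights, `f ∘ π` is `B(F)♯`-invariant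
  have hfinv : ∀ (γ : Γ) (x : (quasiSplit F E c N).Adelic), f (toBorelQuotient F E c N (γ • x)) = f (toBorelQuotient F E c N x) := fun γ x => by
    rw [Subgroup.smul_def, smul_eq_mul, toBorelQuotient_mul_of_mem_map γ.2]
  have hβy := isCoveringWeight_comp_mul_right hβ y
  have key := lintegral_mul_eq_of_coveringSum_eq νG (F := fun g => f (toBorelQuotient F E c N g)) (hf.comp hπm) hfinv hβy.measurable hβ.measurable one_ne_zero
    ENNReal.one_ne_top hβy.coveringSum_eq hβ.coveringSum_eq
  calc ∫⁻ g, β (g * y⁻¹) * f (toBorelQuotient F E c N g) ∂νG = ∫⁻ g, f (toBorelQuotient F E c N g) * β (g * y⁻¹) ∂νG := lintegral_congr fun g => mul_comm _ _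
    _ = ∫⁻ g, f (toBorelQuotient F E c N g) * β g ∂νG := key
    _ = ∫⁻ g, β g * f (toBorelQuotient F E c N g) ∂νG := lintegral_congr fun g => mul_comm _ _

/-! ## §3 The weighted truncated measure `wtm_{k,c} μZ` unfolded to `𝔾` -/

variable [NeZero N]

omit [BorelSpace (quasiSplit F E c N).Adelic] in
/-- **`∫⁻_Z f d(wtm_{k,c} μZ) = ∫⁻_𝔾 β(g) · 𝟙_{c<H(g)} H(g)^{−2k} · f(π g) dν_G`** for Borel `f ≥ 0` (unfold `withDensity` and `restrict`, then the letter; `HZ(π g) = H(g)`).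
[cite: BernsteinLapid2019, §4 p. 10] -/
theorem lintegral_weightedTruncMeasure_eq_of_unfolding (νG : Measure (quasiSplit F E c N).Adelic)
    {β : (quasiSplit F E c N).Adelic → ℝ≥0∞}
    {μZ : Measure (borelQuotient F E c N)}
    (hμZ : ∀ f : borelQuotient F E c N → ℝ≥0∞, Measurable f → ∫⁻ z, f z ∂μZ = ∫⁻ g, β g * f (toBorelQuotient F E c N g) ∂νG)
    (k : ℕ) (c₀ : ℝ≥0) {f : borelQuotient F E c N → ℝ≥0∞} (hf : Measurable f) :
    ∫⁻ z, f z ∂(weightedTruncMeasure F E c N k c₀ μZ) =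
      ∫⁻ g, β g * {y : (quasiSplit F E c N).Adelic | c₀ < borelHeight y}.indicator
        (fun y => (((borelHeight y)⁻¹ ^ (2 * k) : ℝ≥0) : ℝ≥0∞) * f (toBorelQuotient F E c N y)) g ∂νG := by
  have hS : MeasurableSet {z : borelQuotient F E c N | c₀ < borelQuotHeight F E c N z} := measurableSet_lt measurable_const measurable_borelQuotHeight
  have hd : Measurable fun z : borelQuotient F E c N => (((borelQuotHeight F E c N z)⁻¹ ^ (2 * k) : ℝ≥0) : ℝ≥0∞) :=
    (measurable_borelQuotHeight.inv.pow_const _).coe_nnreal_ennreal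
  rw [weightedTruncMeasure, lintegral_withDensity_eq_lintegral_mul _ hd hf, ← lintegral_indicator hS, hμZ _ ((hd.mul hf).indicator hS)]
  exact lintegral_congr fun g => rfl

omit [MeasurableSpace (quasiSplit F E c N).Adelic] [BorelSpace (quasiSplit F E c N).Adelic] in
/-- A class a.e.-strongly measurable for `wtm_{k,c} μZ` gives an a.e.-strongly measurable function `𝟙_{Z_c} · HZ^{−2k} • f` for `μZ` (the density is positive and finite on `Z_c`, so `wtm` and
`μZ|_{Z_c}` are mutually absolutely continuous; Mathlib `withDensity_absolutelyContinuous'`, `aestronglyMeasurable_indicator_iff`). [cite: BernsteinLapid2019, §4 p. 10] -/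
theorem aestronglyMeasurable_indicator_smul_of_weightedTruncMeasure {V : Type*} [NormedAddCommGroup V] [NormedSpace ℝ V]
    {μZ : Measure (borelQuotient F E c N)} (k : ℕ) (c₀ : ℝ≥0) {f : borelQuotient F E c N → V}
    (hf : AEStronglyMeasurable f (weightedTruncMeasure F E c N k c₀ μZ)) :
    AEStronglyMeasurable ({z : borelQuotient F E c N | c₀ < borelQuotHeight F E c N z}.indicator
      fun z => (((borelQuotHeight F E c N z)⁻¹ ^ (2 * k) : ℝ≥0) : ℝ) • f z) μZ := by
  have hS : MeasurableSet {z : borelQuotient F E c N | c₀ < borelQuotHeight F E c N z} := measurableSet_lt measurable_const measurable_borelQuotHeight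
  have hdNN : Measurable fun z : borelQuotient F E c N => ((borelQuotHeight F E c N z)⁻¹ ^ (2 * k) : ℝ≥0) := measurable_borelQuotHeight.inv.pow_const _
  -- `μZ|_S ≪ wtm`
  have hac : μZ.restrict {z : borelQuotient F E c N | c₀ < borelQuotHeight F E c N z} ≪ weightedTruncMeasure F E c N k c₀ μZ := by
    rw [weightedTruncMeasure]
    refine withDensity_absolutelyContinuous' hdNN.coe_nnreal_ennreal.aemeasurable (Eventually.of_forall fun z => ?_)
    have hz : 0 < borelQuotHeight F E c N z := by
      obtain ⟨g, rfl⟩ := Quotient.exists_rep z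
      exact borelHeight_pos g
    exact ENNReal.coe_ne_zero.2 (pow_ne_zero _ (inv_ne_zero hz.ne'))
  have hf' : AEStronglyMeasurable f (μZ.restrict {z : borelQuotient F E c N | c₀ < borelQuotHeight F E c N z}) := hf.mono_ac hac
  exact (aestronglyMeasurable_indicator_iff hS).2 ((hdNN.coe_nnreal_real.aestronglyMeasurable).smul hf')

/-- **THE BOCHNER UNFOLDING of `wtm_{k,c} μZ`**: `∫_Z f d(wtm) = ∫_𝔾 (β g).toReal • 𝟙_{c<H(g)} · (H(g)^{−2k} • f(π g)) dν_G` for every `f` a.e.-strongly measurable w.r.t. `wtm`, any Banach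
target. [cite: BernsteinLapid2019, §4 p. 10] [cite: MoeglinWaldspurger1995, I.2.1] -/
theorem integral_weightedTruncMeasure_eq_of_unfolding {V : Type*} [NormedAddCommGroup V] [NormedSpace ℝ V] [CompleteSpace V]
    (νG : Measure (quasiSplit F E c N).Adelic)
    {β : (quasiSplit F E c N).Adelic → ℝ≥0∞} (hβ : IsCoveringWeight ↥((arithmeticBorel F E c N).map (quasiSplit F E c N).arithmeticSubgroup.subtype) β)
    {μZ : Measure (borelQuotient F E c N)}
    (hμZ : ∀ f : borelQuotient F E c N → ℝ≥0∞, Measurable f → ∫⁻ z, f z ∂μZ = ∫⁻ g, β g * f (toBorelQuotient F E c N g) ∂νG)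
    (k : ℕ) (c₀ : ℝ≥0) {f : borelQuotient F E c N → V} (hf : AEStronglyMeasurable f (weightedTruncMeasure F E c N k c₀ μZ)) :
    ∫ z, f z ∂(weightedTruncMeasure F E c N k c₀ μZ) =
      ∫ g, (β g).toReal • {y : (quasiSplit F E c N).Adelic | c₀ < borelHeight y}.indicator
        (fun y => (((borelHeight y)⁻¹ ^ (2 * k) : ℝ≥0) : ℝ) • f (toBorelQuotient F E c N y)) g ∂νG := by
  have hS : MeasurableSet {z : borelQuotient F E c N | c₀ < borelQuotHeight F E c N z} := measurableSet_lt measurable_const measurable_borelQuotHeight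
  have hd : Measurable fun z : borelQuotient F E c N => (((borelQuotHeight F E c N z)⁻¹ ^ (2 * k) : ℝ≥0) : ℝ≥0∞) :=
    (measurable_borelQuotHeight.inv.pow_const _).coe_nnreal_ennreal
  rw [weightedTruncMeasure, integral_withDensity_eq_integral_toReal_smul hd (Eventually.of_forall fun _ => ENNReal.coe_lt_top), ← integral_indicator hS]
  simp only [ENNReal.coe_toReal]
  rw [integral_eq_integral_toReal_smul_comp_of_unfolding νG hβ hμZ (aestronglyMeasurable_indicator_smul_of_weightedTruncMeasure k c₀ hf)]
  exact integral_congr_ae (Eventually.of_forall fun g => rfl)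

end Summit.HodgeConjecture.HodgeConjecture.Cruxes.H413.K2E1BLQuotientMeasureU

end
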